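import Summits.QuantumFields.GaugeBoot.StrongCouplingCubicSU3Reverse
import Summits.QuantumFields.GaugeBoot.StrongCouplingThirdOrderPieces
import HarnessLib

/-!
# Strong coupling from the loop equation: the spectator sums of the `SU(3)` plaquette through first order (gauge-boot, ADDENDUM 24 part G)

HONEST FRAMING (cell `pub-gaugeboot`, page 1 of every file): the venture produces certified bounds
on lattice expectations at stated coupling, gauge group, dimension and torus size; NOT a mass gap,
NOT a continuum limit, NOT a string tension; NOT Yang–Mills-summit-bearing (barriers
`FixedCouplingUltralocality`, `PerturbativeInvisibility`).  Crude explicit `O(β)` bounds on a finite torus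
`(ℤ/L)^d`, `L ≥ 2`, every real `β` (tree coupling `β = β_std/3`); no number of the cell's tables is certified here.

## Content (`SU(3)`, fundamental representation, plaquette `P̃₀ = plaqWord μ ν₀ true` at `x`, `t = tr U_P`, `t' = tr U_P⁻¹`)

The right sides of the two spectator identities of `StrongCouplingDoublePlaquette`
(`(7/3)E[t²] + E[tr U_P²] = −(β/2)·S₁`, `3E[t t'] − 3 = −(β/2)·S₃`, with `S₁ = ΣΣ E[plaqTerm_{ν,ε}(P̃₀)·t]`,
`S₃ = ΣΣ E[plaqTerm_{ν,ε}(P̃₀)·t']`) through FIRST order in `β`, i.e. their Haar values with explicit `O(β)` remainders: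

* `norm_integral_plaqTerm_mul_trace_le₁` / `…_reverse_le₁` — for `(ν, ε) ≠ (ν₀, +)`: `‖E[plaqTerm_{ν,ε}(P̃₀)·t]‖`,
  `‖E[plaqTerm_{ν,ε}(P̃₀)·t']‖ ≤ 54(d−1)|β|` (read-once bounds at the private links of `q`);
* `norm_integral_plaqTermZero_mul_trace_add_le` — ★ `‖E[plaqTerm_{ν₀,+}(P̃₀)·t] + 4/3‖ ≤ 103(d−1)|β|` (the Haar value
  `−4/3 = (2/3)·1 − 2·1` of `(2/3)(tr U)³ − 2|tr U|²`: the baryon vertex `E[(tr U_P)³] = 1 + O(β)` of `StrongCouplingCubicSU3`);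
* `norm_integral_plaqTermZero_mul_trace_reverse_le` — ★ `‖E[plaqTerm_{ν₀,+}(P̃₀)·t']‖ ≤ 143(d−1)|β|`;
* ★★ `norm_selfSpectatorSum_add_le`: `‖S₁ + 4/3‖ ≤ (103 + 54(2d−3))(d−1)|β|`;
  ★★ `norm_reverseSpectatorSum_le`: `‖S₃‖ ≤ (143 + 54(2d−3))(d−1)|β|` — whence `E|tr U_P|² = 1 + O(β²)` and
  `(7/3)E[t²] + E[tr U_P²] = (2/3)β + O(β²)`, the inputs of the third-order plaquette (`StrongCouplingPlaquetteSU3Third`).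

References: Yu. Makeenko, *Methods of contemporary gauge theory* (2002) Problem 12.7; M. Creutz, *Quarks, gluons and
lattices* (1983) Ch. 8.  Everything is `[folklore]`.
-/

noncomputable section

open MeasureTheory Filter Topology NormedSpace
open scoped Matrix.Norms.Frobenius Matrix ComplexConjugate
open Literature.MathematicalPhysics.QuantumFieldTheory Literature.MathematicalPhysics.QuantumLattice
open Summit.QuantumFields.YangMills.Cruxes.CurvatureAmnesia.WardDefect.SchwingerDyson

namespace Summit.QuantumFields.GaugeBoot

namespace StrongCoupling

variable {d L : ℕ} [NeZero L]

/-! ## The deformation terms with the plaquette (or its reverse) as multiplier are `O(β)` -/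

section OffDiagonal

/-- ★ For `(ν, ε) ≠ (ν₀, +)`, `ν ≠ μ` (`SU(3)`): `‖E[plaqTerm_{ν,ε}(P̃₀)·g]‖ ≤ 54(d−1)|β|` for `g = tr hol v` with `v ∈ {P̃₀, P̃₀⁻¹}`
— each of its four pieces is a read-once bound at a private link of `q = plaqWord μ ν ε`. [folklore] -/
theorem norm_integral_plaqTerm_mul_trace_le₁ (hL : (1 : ZMod L) ≠ 0) (β : ℝ) (x : Site d L) {μ ν₀ ν : Fin d}
    (hμν₀ : μ ≠ ν₀) (hνμ : ν ≠ μ) {ε : Bool} (hne : ¬(ν = ν₀ ∧ ε = true)) {v : Word d}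
    (hv : v = plaqWord μ ν₀ true ∨ v = (plaqWord μ ν₀ true).reverse) :
    ‖∫ U, plaqTerm (fundamentalRep (Fin 3)) 1 x μ U (plaqWord μ ν₀ true) ν ε *
        (fundamentalRep (Fin 3) (wordHolonomy U x v)).trace ∂(wilsonMeasure (d := d) (L := L) (fundamentalRep (Fin 3)) β)‖ ≤
      54 * ((d : ℝ) - 1) * |β| := by
  have hN : 2 ≤ 3 := by norm_num
  have hv' : qEdge x μ ν ε ∉ Word.edgesRead x v := by
    rcases hv with rfl | rfl
    · exact (qEdge_not_mem_plaqWordZero hL x hμν₀ hνμ hne).1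
    · exact (qEdge_not_mem_plaqWordZero hL x hμν₀ hνμ hne).2.1
  have hP : qEdge x μ ν ε ∉ Word.edgesRead x (plaqWord μ ν₀ true) := (qEdge_not_mem_plaqWordZero hL x hμν₀ hνμ hne).1
  have gP := mulData_trace (N := 3) x (plaqWord μ ν₀ true) hP
  have gv := mulData_trace (N := 3) x v hv'
  rw [integral_plaqTerm_mul_trace_suN]
  -- the triple products, reordered with the marked word `q^{±1}` in front
  have hsw : ∀ (w : Word d) (U : GaugeConfig d L (Matrix.specialUnitaryGroup (Fin 3) ℂ)),
      (fundamentalRep (Fin 3) (wordHolonomy U x (plaqWord μ ν₀ true))).trace *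
          (fundamentalRep (Fin 3) (wordHolonomy U x w)).trace * (fundamentalRep (Fin 3) (wordHolonomy U x v)).trace =
        (fundamentalRep (Fin 3) (wordHolonomy U x w)).trace *
          ((fundamentalRep (Fin 3) (wordHolonomy U x (plaqWord μ ν₀ true))).trace *
            (fundamentalRep (Fin 3) (wordHolonomy U x v)).trace) := fun w U => by ring
  simp_rw [hsw]
  have h1 := norm_integral_trace_plaqWord_append_qw_mul_le (d := d) (L := L) hN hL β x hμν₀ hνμ hne (Or.inl rfl) gv
  have h2 := norm_integral_trace_plaqWord_append_qw_mul_le (d := d) (L := L) hN hL β x hμν₀ hνμ hne (Or.inr rfl) gv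
  have h3 := norm_integral_trace_qw_mul_le (d := d) (L := L) hN hL β x hνμ ε (Or.inl rfl) (mulData_mul gP gv)
  have h4 := norm_integral_trace_qw_mul_le (d := d) (L := L) hN hL β x hνμ ε (Or.inr rfl) (mulData_mul gP gv)
  refine (norm_four_piece_le h1 h2 h3 h4).trans (le_of_eq ?_)
  norm_num
  ring

end OffDiagonal

/-! ## The self-deformation terms through their Haar values -/

section Diagonal

omit [NeZero L] in
/-- `hol(P̃₀ · P̃₀⁻¹) = 1`: the trivial deformation has trace `3`. [folklore] -/
theorem trace_plaqWord_append_reverse_su3 (U : GaugeConfig d L (Matrix.specialUnitaryGroup (Fin 3) ℂ)) (x : Site d L)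
    (μ ν₀ : Fin d) :
    (fundamentalRep (Fin 3) (wordHolonomy U x (plaqWord μ ν₀ true ++ (plaqWord μ ν₀ true).reverse))).trace = 3 := by
  rw [wordHolonomy_append_reverse, map_one, Matrix.trace_one, Fintype.card_fin]
  norm_num

/-- ★ **The self-deformation term with spectator `t`, through its Haar value**: `SU(3)`, every `L ≥ 2`, every real `β`:
`‖E[plaqTerm_{ν₀,+}(P̃₀)·tr U_P] + 4/3‖ ≤ 103(d−1)|β|` (`plaqTerm_{ν₀,+}(P̃₀)·t = tr U_P²·t − 3t − (1/3)(t³ − t²t')`, and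
`E[tr U_P² t] = κ − 2m`, `κ = 1 + O(β)`, `m = 1 + O(β)`). [folklore] -/
theorem norm_integral_plaqTermZero_mul_trace_add_le (hL : (1 : ZMod L) ≠ 0) (β : ℝ) (x : Site d L) {μ ν₀ : Fin d}
    (hμν₀ : μ ≠ ν₀) :
    ‖(∫ U, plaqTerm (fundamentalRep (Fin 3)) 1 x μ U (plaqWord μ ν₀ true) ν₀ true *
        (fundamentalRep (Fin 3) (wordHolonomy U x (plaqWord μ ν₀ true))).trace
          ∂(wilsonMeasure (d := d) (L := L) (fundamentalRep (Fin 3)) β)) + 4 / 3‖ ≤ 103 * ((d : ℝ) - 1) * |β| := by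
  haveI := isProbabilityMeasure_wilsonMeasure (d := d) (L := L) (fundamentalRep (Fin 3)) (continuous_fundamentalRep (Fin 3)) β
  have hP : Word.endpoint x (plaqWord μ ν₀ true) = x := endpoint_plaqWord x μ ν₀ true
  set t : GaugeConfig d L (Matrix.specialUnitaryGroup (Fin 3) ℂ) → ℂ :=
    fun U => (fundamentalRep (Fin 3) (wordHolonomy U x (plaqWord μ ν₀ true))).trace with ht
  set t' : GaugeConfig d L (Matrix.specialUnitaryGroup (Fin 3) ℂ) → ℂ :=
    fun U => (fundamentalRep (Fin 3) (wordHolonomy U x (plaqWord μ ν₀ true).reverse)).trace with ht'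
  have hc : ∀ u : Word d, Continuous fun U : GaugeConfig d L (Matrix.specialUnitaryGroup (Fin 3) ℂ) =>
      (fundamentalRep (Fin 3) (wordHolonomy U x u)).trace := fun u => continuous_trace_wordHolonomy (fundamentalLatticeRep 3) x u
  rw [integral_plaqTerm_mul_trace_suN]
  simp_rw [trace_plaqWord_append_reverse_su3]
  -- `E[tr U_P² · t] = κ − 2m`
  have hNewton : ∀ U : GaugeConfig d L (Matrix.specialUnitaryGroup (Fin 3) ℂ),
      (fundamentalRep (Fin 3) (wordHolonomy U x (plaqWord μ ν₀ true ++ plaqWord μ ν₀ true))).trace * t U =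
        t U * t U * t U - 2 * (t U * t' U) := fun U => by
    rw [su3_trace_append_self U x _ hP, ht, ht']; ring
  have hiK : Integrable (fun U => t U * t U * t U) (wilsonMeasure (d := d) (L := L) (fundamentalRep (Fin 3)) β) :=
    integrable_of_continuous (fundamentalLatticeRep 3) β (((hc _).mul (hc _)).mul (hc _))
  have hiM : Integrable (fun U => t U * t' U) (wilsonMeasure (d := d) (L := L) (fundamentalRep (Fin 3)) β) :=
    integrable_of_continuous (fundamentalLatticeRep 3) β ((hc _).mul (hc _))
  have hy : ∫ U, (fundamentalRep (Fin 3) (wordHolonomy U x (plaqWord μ ν₀ true ++ plaqWord μ ν₀ true))).trace * t U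
      ∂(wilsonMeasure (d := d) (L := L) (fundamentalRep (Fin 3)) β) =
      (∫ U, t U * t U * t U ∂(wilsonMeasure (d := d) (L := L) (fundamentalRep (Fin 3)) β)) -
        2 * ∫ U, t U * t' U ∂(wilsonMeasure (d := d) (L := L) (fundamentalRep (Fin 3)) β) := by
    simp_rw [hNewton]
    rw [integral_sub hiK (hiM.const_mul _), integral_const_mul]
  have h3t : ∫ U, (3 : ℂ) * t U ∂(wilsonMeasure (d := d) (L := L) (fundamentalRep (Fin 3)) β) =
      3 * ∫ U, t U ∂(wilsonMeasure (d := d) (L := L) (fundamentalRep (Fin 3)) β) := integral_const_mul _ _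
  have hsw : ∫ U, t U * t' U * t U ∂(wilsonMeasure (d := d) (L := L) (fundamentalRep (Fin 3)) β) =
      ∫ U, t U * t U * t' U ∂(wilsonMeasure (d := d) (L := L) (fundamentalRep (Fin 3)) β) :=
    integral_congr_ae (ae_of_all _ fun U => by ring)
  rw [hsw, hy, h3t]
  -- the four inputs
  have hκ := norm_integral_trace_cube_sub_one_su3_le (d := d) (L := L) hL β x hμν₀
  have hm := norm_integral_trace_mul_trace_reverse_sub_one_suN_le (d := d) (L := L) (N := 3) (by norm_num) hL β x hμν₀
  have hτ := norm_integral_trace_plaqWord_su3_le (d := d) (L := L) hL β x hμν₀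
  have he := norm_integral_trace_sq_mul_trace_reverse_su3_le (d := d) (L := L) hL β x hμν₀
  set κ := ∫ U, t U * t U * t U ∂(wilsonMeasure (d := d) (L := L) (fundamentalRep (Fin 3)) β) with hκdef
  set m := ∫ U, t U * t' U ∂(wilsonMeasure (d := d) (L := L) (fundamentalRep (Fin 3)) β) with hmdef
  set τ := ∫ U, t U ∂(wilsonMeasure (d := d) (L := L) (fundamentalRep (Fin 3)) β) with hτdef
  set e₃ := ∫ U, t U * t U * t' U ∂(wilsonMeasure (d := d) (L := L) (fundamentalRep (Fin 3)) β) with hedef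
  have hid : κ - 2 * m - 3 * τ - 1 / ((3 : ℕ) : ℂ) * (κ - e₃) + 4 / 3 =
      2 / 3 * (κ - 1) - 2 * (m - 1) - 3 * τ + 1 / 3 * e₃ := by push_cast; ring
  rw [hid]
  have hn1 : ‖(2 / 3 : ℂ) * (κ - 1)‖ ≤ 2 / 3 * (30 * ((d : ℝ) - 1) * |β|) := by
    rw [norm_mul, show ‖(2 / 3 : ℂ)‖ = 2 / 3 by
      rw [show (2 / 3 : ℂ) = ((2 / 3 : ℝ) : ℂ) by push_cast; ring, Complex.norm_real, Real.norm_eq_abs]; norm_num]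
    exact mul_le_mul_of_nonneg_left hκ (by norm_num)
  have hn2 : ‖(2 : ℂ) * (m - 1)‖ ≤ 2 * (4 * ((d : ℝ) - 1) * (3 : ℕ) * |β|) := by
    rw [norm_mul, Complex.norm_ofNat]; exact mul_le_mul_of_nonneg_left hm (by norm_num)
  have hn3 : ‖(3 : ℂ) * τ‖ ≤ 3 * (9 * ((d : ℝ) - 1) * |β| / 2) := by
    rw [norm_mul, Complex.norm_ofNat]; exact mul_le_mul_of_nonneg_left hτ (by norm_num)
  have hn4 : ‖(1 / 3 : ℂ) * e₃‖ ≤ 1 / 3 * (136 * ((d : ℝ) - 1) * |β|) := by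
    rw [norm_mul, show ‖(1 / 3 : ℂ)‖ = 1 / 3 by
      rw [show (1 / 3 : ℂ) = ((1 / 3 : ℝ) : ℂ) by push_cast; ring, Complex.norm_real, Real.norm_eq_abs]; norm_num]
    exact mul_le_mul_of_nonneg_left he (by norm_num)
  have htot := (norm_add_le _ _).trans (add_le_add ((norm_sub_le _ _).trans (add_le_add ((norm_sub_le _ _).trans
    (add_le_add hn1 hn2)) hn3)) hn4)
  refine htot.trans ?_
  push_cast
  nlinarith [abs_nonneg β, sub_one_nonneg_of_axis (d := d) μ]

/-- ★ **The self-deformation term with spectator `t' = tr U_P⁻¹`**: `‖E[plaqTerm_{ν₀,+}(P̃₀)·tr U_P⁻¹]‖ ≤ 143(d−1)|β|`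
(`= y' − 3τ̄' − (1/3)(e₃ − conj e₃)`, all `O(β)`). [folklore] -/
theorem norm_integral_plaqTermZero_mul_trace_reverse_le (hL : (1 : ZMod L) ≠ 0) (β : ℝ) (x : Site d L) {μ ν₀ : Fin d}
    (hμν₀ : μ ≠ ν₀) :
    ‖∫ U, plaqTerm (fundamentalRep (Fin 3)) 1 x μ U (plaqWord μ ν₀ true) ν₀ true *
        (fundamentalRep (Fin 3) (wordHolonomy U x (plaqWord μ ν₀ true).reverse)).trace
          ∂(wilsonMeasure (d := d) (L := L) (fundamentalRep (Fin 3)) β)‖ ≤ 143 * ((d : ℝ) - 1) * |β| := by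
  have hP : Word.endpoint x (plaqWord μ ν₀ true) = x := endpoint_plaqWord x μ ν₀ true
  set t : GaugeConfig d L (Matrix.specialUnitaryGroup (Fin 3) ℂ) → ℂ :=
    fun U => (fundamentalRep (Fin 3) (wordHolonomy U x (plaqWord μ ν₀ true))).trace with ht
  set t' : GaugeConfig d L (Matrix.specialUnitaryGroup (Fin 3) ℂ) → ℂ :=
    fun U => (fundamentalRep (Fin 3) (wordHolonomy U x (plaqWord μ ν₀ true).reverse)).trace with ht'
  rw [integral_plaqTerm_mul_trace_suN]
  simp_rw [trace_plaqWord_append_reverse_su3]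
  have h3t : ∫ U, (3 : ℂ) * t' U ∂(wilsonMeasure (d := d) (L := L) (fundamentalRep (Fin 3)) β) =
      3 * ∫ U, t' U ∂(wilsonMeasure (d := d) (L := L) (fundamentalRep (Fin 3)) β) := integral_const_mul _ _
  rw [h3t]
  -- inputs
  have hy := norm_integral_trace_double_mul_trace_reverse_su3_le (d := d) (L := L) hL β x hμν₀
  have hτ := norm_integral_trace_plaqWord_su3_le (d := d) (L := L) hL β x hμν₀
  have he := norm_integral_trace_sq_mul_trace_reverse_su3_le (d := d) (L := L) hL β x hμν₀
  -- `E[t'] = conj E[t]`, `E[t t' t'] = conj E[t t t']`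
  have hconj1 : ∫ U, t' U ∂(wilsonMeasure (d := d) (L := L) (fundamentalRep (Fin 3)) β) =
      conj (∫ U, t U ∂(wilsonMeasure (d := d) (L := L) (fundamentalRep (Fin 3)) β)) := by
    rw [← integral_conj]
    refine integral_congr_ae (ae_of_all _ fun U => ?_)
    simp only [ht', ht]
    exact trace_wordHolonomy_reverse_eq_conj U x _ hP
  have hconj3 : ∫ U, t U * t' U * t' U ∂(wilsonMeasure (d := d) (L := L) (fundamentalRep (Fin 3)) β) =
      conj (∫ U, t U * t U * t' U ∂(wilsonMeasure (d := d) (L := L) (fundamentalRep (Fin 3)) β)) := by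
    rw [← integral_conj]
    refine integral_congr_ae (ae_of_all _ fun U => ?_)
    simp only [ht', ht, map_mul]
    rw [trace_wordHolonomy_reverse_eq_conj U x _ hP, Complex.conj_conj]
    ring
  rw [hconj1, hconj3]
  have hτ' : ‖(3 : ℂ) * conj (∫ U, t U ∂(wilsonMeasure (d := d) (L := L) (fundamentalRep (Fin 3)) β))‖ ≤
      3 * (9 * ((d : ℝ) - 1) * |β| / 2) := by
    rw [norm_mul, Complex.norm_ofNat, Complex.norm_conj]; exact mul_le_mul_of_nonneg_left hτ (by norm_num)
  have he' : ‖1 / ((3 : ℕ) : ℂ) * ((∫ U, t U * t U * t' U ∂(wilsonMeasure (d := d) (L := L) (fundamentalRep (Fin 3)) β)) -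
      conj (∫ U, t U * t U * t' U ∂(wilsonMeasure (d := d) (L := L) (fundamentalRep (Fin 3)) β)))‖ ≤
      1 / 3 * (136 * ((d : ℝ) - 1) * |β| + 136 * ((d : ℝ) - 1) * |β|) := by
    rw [norm_mul, show ‖(1 / ((3 : ℕ) : ℂ))‖ = 1 / 3 by rw [norm_div, norm_one, Complex.norm_natCast]; norm_num]
    refine mul_le_mul_of_nonneg_left ((norm_sub_le _ _).trans (add_le_add he ?_)) (by norm_num)
    rw [Complex.norm_conj]; exact he
  have htot := (norm_sub_le _ _).trans (add_le_add ((norm_sub_le _ _).trans (add_le_add hy hτ')) he')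
  refine htot.trans ?_
  nlinarith [abs_nonneg β, sub_one_nonneg_of_axis (d := d) μ]

end Diagonal

/-! ## The spectator sums through first order -/

section Sums

omit [NeZero L] in
/-- Splitting a double sum over the plaquettes through `(x, μ)` at the marked one `(ν₀, +)`. [folklore] -/
theorem sum_sum_eq_add {μ ν₀ : Fin d} (hν₀ : ν₀ ∈ Finset.univ.erase μ) (g : Fin d → Bool → ℂ) :
    ∑ ν ∈ Finset.univ.erase μ, ∑ ε : Bool, g ν ε =
      g ν₀ true + (∑ ν ∈ (Finset.univ.erase μ).erase ν₀, g ν true + ∑ ν ∈ Finset.univ.erase μ, g ν false) := by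
  have h1 : ∑ ν ∈ Finset.univ.erase μ, ∑ ε : Bool, g ν ε =
      ∑ ν ∈ Finset.univ.erase μ, g ν true + ∑ ν ∈ Finset.univ.erase μ, g ν false := by
    rw [← Finset.sum_add_distrib]
    exact Finset.sum_congr rfl fun ν _ => Fintype.sum_bool _
  rw [h1, ← Finset.add_sum_erase _ _ hν₀]
  ring

omit [NeZero L] in
/-- The off-diagonal part of the double sum has `2d − 3` terms, each bounded by `B`. [folklore] -/
theorem norm_offDiagonal_le {μ ν₀ : Fin d} (hμν₀ : μ ≠ ν₀) (g : Fin d → Bool → ℂ) {B : ℝ}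
    (ht : ∀ ν ∈ (Finset.univ.erase μ).erase ν₀, ‖g ν true‖ ≤ B) (hf : ∀ ν ∈ Finset.univ.erase μ, ‖g ν false‖ ≤ B) :
    ‖∑ ν ∈ (Finset.univ.erase μ).erase ν₀, g ν true + ∑ ν ∈ Finset.univ.erase μ, g ν false‖ ≤ (2 * (d : ℝ) - 3) * B := by
  have hν₀ : ν₀ ∈ Finset.univ.erase μ := Finset.mem_erase.2 ⟨fun h => hμν₀ h.symm, Finset.mem_univ _⟩
  have hcard : (((Finset.univ.erase μ).erase ν₀).card : ℝ) = (d : ℝ) - 1 - 1 := by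
    rw [Finset.card_erase_of_mem hν₀, Nat.cast_sub (Finset.card_pos.2 ⟨ν₀, hν₀⟩), Nat.cast_one, card_univ_erase_real]
  refine (norm_add_le _ _).trans ?_
  have h1 := (norm_sum_le _ _).trans (Finset.sum_le_sum ht)
  have h2 := (norm_sum_le _ _).trans (Finset.sum_le_sum hf)
  rw [Finset.sum_const, nsmul_eq_mul, hcard] at h1
  rw [Finset.sum_const, nsmul_eq_mul, card_univ_erase_real] at h2
  linarith

/-- ★★ **`S₁ + 4/3 = O(β)`**: `‖ΣΣ E[plaqTerm_{ν,ε}(P̃₀)·tr U_P] + 4/3‖ ≤ (103 + 54(2d−3))(d−1)|β|` — with the self-spectator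
identity, `(7/3)E[(tr U_P)²] + E[tr U_P²] = (2/3)β + O(β²)`. [folklore] -/
theorem norm_selfSpectatorSum_add_le (hL : (1 : ZMod L) ≠ 0) (β : ℝ) (x : Site d L) {μ ν₀ : Fin d} (hμν₀ : μ ≠ ν₀) :
    ‖(∑ ν ∈ Finset.univ.erase μ, ∑ ε : Bool, ∫ U, plaqTerm (fundamentalRep (Fin 3)) 1 x μ U (plaqWord μ ν₀ true) ν ε *
        (fundamentalRep (Fin 3) (wordHolonomy U x (plaqWord μ ν₀ true))).trace
          ∂(wilsonMeasure (d := d) (L := L) (fundamentalRep (Fin 3)) β)) + 4 / 3‖ ≤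
      (103 + 54 * (2 * (d : ℝ) - 3)) * ((d : ℝ) - 1) * |β| := by
  have hν₀ : ν₀ ∈ Finset.univ.erase μ := Finset.mem_erase.2 ⟨fun h => hμν₀ h.symm, Finset.mem_univ _⟩
  rw [sum_sum_eq_add hν₀, add_assoc, add_comm (∑ ν ∈ (Finset.univ.erase μ).erase ν₀, _ + _) (4 / 3 : ℂ), ← add_assoc]
  have h0 := norm_integral_plaqTermZero_mul_trace_add_le (d := d) (L := L) hL β x hμν₀
  have hoff := norm_offDiagonal_le hμν₀ (fun ν ε => ∫ U, plaqTerm (fundamentalRep (Fin 3)) 1 x μ U (plaqWord μ ν₀ true) ν ε *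
      (fundamentalRep (Fin 3) (wordHolonomy U x (plaqWord μ ν₀ true))).trace ∂(wilsonMeasure (d := d) (L := L) (fundamentalRep (Fin 3)) β))
    (B := 54 * ((d : ℝ) - 1) * |β|)
    (fun ν hν => by
      obtain ⟨hνν₀, hν'⟩ := Finset.mem_erase.1 hν
      have hνμ : ν ≠ μ := (Finset.mem_erase.1 hν').1
      exact norm_integral_plaqTerm_mul_trace_le₁ hL β x hμν₀ hνμ (fun h => hνν₀ h.1) (Or.inl rfl))
    (fun ν hν => by
      have hνμ : ν ≠ μ := (Finset.mem_erase.1 hν).1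
      exact norm_integral_plaqTerm_mul_trace_le₁ hL β x hμν₀ hνμ (fun h => Bool.false_ne_true h.2) (Or.inl rfl))
  refine (norm_add_le _ _).trans ((add_le_add h0 hoff).trans (le_of_eq ?_))
  ring

/-- ★★ **`S₃ = O(β)`**: `‖ΣΣ E[plaqTerm_{ν,ε}(P̃₀)·tr U_P⁻¹]‖ ≤ (143 + 54(2d−3))(d−1)|β|` — with the reverse-spectator identity
`3E|tr U_P|² − 3 = −(β/2)S₃`: `E|tr U_P|² = 1 + O(β²)`. [folklore] -/
theorem norm_reverseSpectatorSum_le (hL : (1 : ZMod L) ≠ 0) (β : ℝ) (x : Site d L) {μ ν₀ : Fin d} (hμν₀ : μ ≠ ν₀) :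
    ‖∑ ν ∈ Finset.univ.erase μ, ∑ ε : Bool, ∫ U, plaqTerm (fundamentalRep (Fin 3)) 1 x μ U (plaqWord μ ν₀ true) ν ε *
        (fundamentalRep (Fin 3) (wordHolonomy U x (plaqWord μ ν₀ true).reverse)).trace
          ∂(wilsonMeasure (d := d) (L := L) (fundamentalRep (Fin 3)) β)‖ ≤
      (143 + 54 * (2 * (d : ℝ) - 3)) * ((d : ℝ) - 1) * |β| := by
  have hν₀ : ν₀ ∈ Finset.univ.erase μ := Finset.mem_erase.2 ⟨fun h => hμν₀ h.symm, Finset.mem_univ _⟩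
  rw [sum_sum_eq_add hν₀]
  have h0 := norm_integral_plaqTermZero_mul_trace_reverse_le (d := d) (L := L) hL β x hμν₀
  have hoff := norm_offDiagonal_le hμν₀ (fun ν ε => ∫ U, plaqTerm (fundamentalRep (Fin 3)) 1 x μ U (plaqWord μ ν₀ true) ν ε *
      (fundamentalRep (Fin 3) (wordHolonomy U x (plaqWord μ ν₀ true).reverse)).trace
        ∂(wilsonMeasure (d := d) (L := L) (fundamentalRep (Fin 3)) β))
    (B := 54 * ((d : ℝ) - 1) * |β|)
    (fun ν hν => by
      obtain ⟨hνν₀, hν'⟩ := Finset.mem_erase.1 hν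
      have hνμ : ν ≠ μ := (Finset.mem_erase.1 hν').1
      exact norm_integral_plaqTerm_mul_trace_le₁ hL β x hμν₀ hνμ (fun h => hνν₀ h.1) (Or.inr rfl))
    (fun ν hν => by
      have hνμ : ν ≠ μ := (Finset.mem_erase.1 hν).1
      exact norm_integral_plaqTerm_mul_trace_le₁ hL β x hμν₀ hνμ (fun h => Bool.false_ne_true h.2) (Or.inr rfl))
  refine (norm_add_le _ _).trans ((add_le_add h0 hoff).trans (le_of_eq ?_))
  ring

end Sums

end StrongCoupling

end Summit.QuantumFields.GaugeBoot

end
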